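import Literature.MathematicalPhysics.QuantumFieldTheory.Balaban1983to89.B13Lemma3TorusCauchy

/-!
# Spine/NE5/TwoRunTorusRateCauchy — the two pencil hypotheses of `Spine/NE5/TwoRunTorusRate` §3 (θ-holomorphy of the
# (2.14)-terms, (2.26) uniform in θ) FROM THE (2.14) LAYER: holomorphy in a parameter through the corner values, and the
# Cauchy mechanism per pencil member (cell `pub-balaban-gaps`, seat `ne5` gen 7)

WHY.  `TwoRunTorusRate.norm_E_sub_le_torus` derives NE5's inequality at one paired scale on the two-scale torus model
from a pencil of (2.14)-TERM families `θ ↦ P Z t φ θ` that is (i) holomorphic on the disc `‖θ‖ < ρ` and (ii) obeys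
(2.26) uniformly there.  This file reduces (i) and (ii) to the layer below — the (2.14)-form of the terms with their
underintegral expression `Ψ` ([II] p. 15) — exactly as the tree reduced «(2.26) per term» for ONE run
(`B13Lemma3TorusCauchy.h226_torus_of_cauchy`):
* §1 `differentiableOn_term214_param` (generic, any complex parameter space `B`): `b ↦ term214 r lZ lD (Ψ b) σ₀ τ₀` is
  complex differentiable on `V ⊆ B` as soon as each member `Ψ b` is separately holomorphic in the `σ` on `Uσ` and in
  the `τ` on `Uτ` (two domains, as in `B13CauchyDecay.norm_term214_le`) and the CORNER VALUES `b ↦ Ψ b σ τ` are complex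
  differentiable on `V` — on `V` the term IS the finite signed double difference `D^σD^τ Ψ b` of corner values
  (`B13Term214.term214_eq_DopC` ∕ `TopC_congr` ∕ `B13CauchyDecay.sepHolOn_DopC_inner`).  No joint analyticity in
  `(b, σ, τ)` is needed.  (Same device as `B13CauchyDecay.analyticOnNhd_TopC_param` for (1.38), one parameter family.)
* §2 on the torus model: `pencil_hol_of_corners` — hypothesis (i) from the (2.14)-form of the pencil members, their
  separate σ∕τ-holomorphy and the POINTWISE θ-differentiability of `Ψ` at admissible `(σ, τ)` (for the block model this
  is T11 `B13Core214Holomorphic.differentiableOn_core214X` along the operator pencil); `pencil_h226_of_cauchy` —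
  hypothesis (ii) from `h226_torus_of_cauchy` applied at each θ (separate holomorphy at the (2.18) radii + the Gaussian
  sup bound (2.15)–(2.25) UNIFORM in θ).
LEDGER MEANING (row NE5, `HOME/ne/NE5.md` §7): on the papers' periodic carrier NE5 at scale j now reads, BY NAME, «the
two runs' (2.14)-terms are the end members of a pencil of generic terms (2.14) whose underintegral expressions are
separately holomorphic at the printed radii, pointwise holomorphic in θ, and obey the Gaussian sup bound (2.15)–(2.25)
uniformly on the disc ‖θ‖ < s∕r_j» + Lemma 3's and (2.39)–(2.41)'s numbers.  The sup bound uniform along the pencil is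
the CLASS statement of [II] (1.5) p. 3 for NE5's pencil (T8–T13 one layer below; H4–H7 at the formula layer); `r_j` is
rows NE2∕NE3's termwise local rate; `s` the fixed margin.

HONEST FRAMING.  Plumbing + one-parameter complex analysis over LANDED shapes; `P`, `Ψ`, the lists, radii and every
constant are HYPOTHESES ∕ parameters; nothing of Bałaban's is constructed or asserted; NE5 NOT PRINTED ∕ NOT PROVED;
leaves 0∕12; (D4) 0∕1; spine 0∕9.  Rung (B)+1 on a FIXED finite T⁴ — NOT continuum, NOT infinite volume, NOT mass gap,
NOT Clay.  HONEST DEPENDENCY: continuum YM on T⁴ ⇐ BetaPertH ∧ nine spine estimates; BetaPertH ⇐ (D1) ∧ (D4) ∧ CAP+tail.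
0 sorry, 0 `def`.

Sources: [II] = T. Bałaban, CMP **116** (1988) 1–22 [Balaban1988RG2Cluster] (2.14)–(2.15) p. 15, (2.18) p. 16, (2.26)
p. 17; C. King, CMP **102** (1986) [King1986] p. 665.  Nothing here is a claim about the Yang–Mills mass gap.
-/

noncomputable section

namespace Summit.QuantumFields.BalabanUV.T4Continuum.Spine.NE5.TwoRunTorusRateCauchy

open Metric Set Finset
open Literature.MathematicalPhysics.QuantumFieldTheory.Balaban1983to89
open Literature.MathematicalPhysics.QuantumFieldTheory.Balaban1983to89.TreeLengthTorus (TPt TDom tsys)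
open Literature.MathematicalPhysics.QuantumFieldTheory.Balaban1983to89.TreeLengthTorusTransfer (tclosure)
open Literature.MathematicalPhysics.QuantumFieldTheory.Balaban1983to89.B13Lemma3TorusData (TBond)
open Literature.MathematicalPhysics.QuantumFieldTheory.Balaban1983to89.B13Lemma3Torus (TwoTorusStep)
open Literature.MathematicalPhysics.QuantumFieldTheory.Balaban1983to89.B13Lemma3TorusTerms (terms weight Z0)
open Literature.MathematicalPhysics.QuantumFieldTheory.Balaban1983to89.B13Term214
  (cornerC DopC TopC SepHolOn term214 TopC_congr TopC_eq_DopC)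
open Literature.MathematicalPhysics.QuantumFieldTheory.Balaban1983to89.B13CauchyDecay (sepHolOn_DopC_inner)
open Literature.MathematicalPhysics.QuantumFieldTheory.Balaban1983to89.B13Lemma3TorusCauchy (h226_torus_of_cauchy)
open Literature.MathematicalPhysics.QuantumFieldTheory.Balaban1983to89.B13Bound143 (invTau)

/-! ## §1. The generic term (2.14) is holomorphic in any complex parameter through its corner values -/

section Param214

variable {E : Type*} [NormedAddCommGroup E] [NormedSpace ℂ E] [CompleteSpace E]
variable {ι : Type*} [DecidableEq ι] {κ : Type*} [DecidableEq κ]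
variable {B : Type*} [NormedAddCommGroup B] [NormedSpace ℂ B]

/-- Corners of `{0,1}^S` over a base point with coordinates in `U ∋ 0, 1` have coordinates in `U` (plumbing).
[cite: Balaban1988RG2Cluster, (2.14) p.15] (elementary API for (2.14)) -/
private theorem cornerC_mem' {U : Set ℂ} (h0 : (0 : ℂ) ∈ U) (h1 : (1 : ℂ) ∈ U) (S T : Finset ι) {p : ι → ℂ}
    (hp : ∀ j, p j ∈ U) (j : ι) : cornerC S T p j ∈ U := by
  unfold cornerC
  split_ifs
  · exact h1
  · exact h0
  · exact hp j

/-- **THE GENERIC TERM (2.14) IS HOLOMORPHIC IN ANY COMPLEX PARAMETER THROUGH ITS CORNER VALUES.**  For a family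
`b ↦ Ψ b` (`b` in a set `V` of a complex normed space — a background seam, a coupling, NE5's two-run pencil parameter)
whose members are separately holomorphic in the `σ` on an open `Uσ` (for admissible `τ`) and in the `τ` on an open
`Uτ` (for admissible `σ`), both containing the closed `r`-discs about `[0, 1]`, and whose CORNER VALUES `b ↦ Ψ b σ τ`
are complex differentiable on `V` for all admissible `(σ, τ)`: the term `b ↦ term214 r lZ lD (Ψ b) σ₀ τ₀` is complex
differentiable on `V` — on `V` it is the finite signed double difference `D^σ_{lZ} D^τ_{lD} Ψ b` of corner values
(`B13Term214.term214_eq_DopC` with two domains, as in `B13CauchyDecay.norm_term214_le`).  No joint analyticity in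
`(b, σ, τ)` is needed. [cite: Balaban1988RG2Cluster, (2.14) p.15] -/
theorem differentiableOn_term214_param {Uσ Uτ : Set ℂ} (hUσ : IsOpen Uσ) (hUτ : IsOpen Uτ) {r : ℝ} (hr : 0 < r)
    (hsubσ : ∀ s ∈ Set.uIcc (0 : ℝ) 1, closedBall (s : ℂ) r ⊆ Uσ)
    (hsubτ : ∀ s ∈ Set.uIcc (0 : ℝ) 1, closedBall (s : ℂ) r ⊆ Uτ) {V : Set B}
    {Ψ : B → (ι → ℂ) → (κ → ℂ) → E}
    (hΨσ : ∀ b ∈ V, ∀ τ : κ → ℂ, (∀ j, τ j ∈ Uτ) → SepHolOn Uσ (fun σ => Ψ b σ τ))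
    (hΨτ : ∀ b ∈ V, ∀ σ : ι → ℂ, (∀ j, σ j ∈ Uσ) → SepHolOn Uτ (fun τ => Ψ b σ τ))
    (hpt : ∀ (σ : ι → ℂ) (τ : κ → ℂ), (∀ j, σ j ∈ Uσ) → (∀ j, τ j ∈ Uτ) →
      DifferentiableOn ℂ (fun b => Ψ b σ τ) V)
    {lZ : List ι} (hlZ : lZ.Nodup) {lD : List κ} (hlD : lD.Nodup) {σ₀ : ι → ℂ} (hσ₀ : ∀ j, σ₀ j ∈ Uσ)
    {τ₀ : κ → ℂ} (hτ₀ : ∀ j, τ₀ j ∈ Uτ) :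
    DifferentiableOn ℂ (fun b => term214 r lZ lD (Ψ b) σ₀ τ₀) V := by
  have h0σ : (0 : ℂ) ∈ Uσ := by simpa using hsubσ 0 (by simp) (mem_closedBall_self hr.le)
  have h1σ : (1 : ℂ) ∈ Uσ := by simpa using hsubσ 1 (by simp) (mem_closedBall_self hr.le)
  have h0τ : (0 : ℂ) ∈ Uτ := by simpa using hsubτ 0 (by simp) (mem_closedBall_self hr.le)
  have h1τ : (1 : ℂ) ∈ Uτ := by simpa using hsubτ 1 (by simp) (mem_closedBall_self hr.le)
  -- on `V` the Cauchy form is the double difference form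
  have heq : ∀ b ∈ V, term214 r lZ lD (Ψ b) σ₀ τ₀ =
      DopC lZ.toFinset (fun σ => DopC lD.toFinset (fun τ => Ψ b σ τ) τ₀) σ₀ := by
    intro b hb
    unfold term214
    rw [TopC_congr hr hsubσ (fun σ hσ => TopC_eq_DopC hUτ hr hsubτ (hΨτ b hb σ hσ) lD hlD τ₀ hτ₀) lZ σ₀ hσ₀]
    exact TopC_eq_DopC hUσ hr hsubσ (sepHolOn_DopC_inner h0τ h1τ (hΨσ b hb) lD.toFinset hτ₀) lZ hlZ σ₀ hσ₀
  -- the double difference form is a finite signed sum of corner values, each differentiable in `b`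
  have hD : DifferentiableOn ℂ
      (fun b => DopC lZ.toFinset (fun σ => DopC lD.toFinset (fun τ => Ψ b σ τ) τ₀) σ₀) V := by
    have key : (fun b => DopC lZ.toFinset (fun σ => DopC lD.toFinset (fun τ => Ψ b σ τ) τ₀) σ₀)
        = fun b => ∑ T ∈ lZ.toFinset.powerset, ((-1 : ℂ) ^ (lZ.toFinset \ T).card) •
            ∑ T' ∈ lD.toFinset.powerset, ((-1 : ℂ) ^ (lD.toFinset \ T').card) •
              Ψ b (cornerC lZ.toFinset T σ₀) (cornerC lD.toFinset T' τ₀) := rfl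
    rw [key]
    refine DifferentiableOn.fun_sum fun T _ => DifferentiableOn.const_smul ?_ _
    refine DifferentiableOn.fun_sum fun T' _ => DifferentiableOn.const_smul ?_ _
    exact hpt _ _ (cornerC_mem' h0σ h1σ _ T hσ₀) (cornerC_mem' h0τ h1τ _ T' hτ₀)
  exact hD.congr heq

end Param214

/-! ## §2. The torus model: the two pencil hypotheses of `TwoRunTorusRate` §3 from the (2.14) layer -/

section TorusCauchy

variable {L N' : ℕ} [NeZero L] [NeZero N'] {M : ℕ} [NeZero M]

open Classical in
/-- **THE HOLOMORPHY HYPOTHESIS `hPhol` FROM THE (2.14) LAYER** (torus model): if every pencil member's term is the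
generic term (2.14), `P Z t φ θ = term214 r (lZ Z t) (lD t) (Ψ Z t φ θ) 0 0` for `‖θ‖ < ρ`, with `Ψ Z t φ θ` separately
holomorphic in `σ` on `Uσ` and in `τ` on `Uτ`, and the corner values `θ ↦ Ψ Z t φ θ σ τ` complex differentiable on the
disc for admissible `(σ, τ)` (block model: T11 `B13Core214Holomorphic.differentiableOn_core214X` along the operator
pencil), then `θ ↦ P Z t φ θ` is complex differentiable on the disc — hypothesis `hPhol` of
`TwoRunTorusRate.norm_H_sub_le_torus` ∕ `norm_E_sub_le_torus`. [cite: Balaban1988RG2Cluster, (2.14) p.15] -/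
theorem pencil_hol_of_corners (W : TwoTorusStep 4 L N')
    (P : (Z : TDom 4 N') → Finset (TDom 4 (L * N')) × Finset (TBond 4 M (L * N')) → W.Φ → ℂ → ℂ) {ρ : ℝ}
    {Uσ Uτ : Set ℂ} (hUσ : IsOpen Uσ) (hUτ : IsOpen Uτ) {r : ℝ} (hr : 0 < r)
    (hsubσ : ∀ s ∈ Set.uIcc (0 : ℝ) 1, closedBall (s : ℂ) r ⊆ Uσ)
    (hsubτ : ∀ s ∈ Set.uIcc (0 : ℝ) 1, closedBall (s : ℂ) r ⊆ Uτ)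
    (lZ : TDom 4 N' → Finset (TDom 4 (L * N')) × Finset (TBond 4 M (L * N')) → List (TPt 4 N'))
    (hlZ : ∀ Z t, (lZ Z t).Nodup)
    (lD : Finset (TDom 4 (L * N')) × Finset (TBond 4 M (L * N')) → List (TDom 4 (L * N')))
    (hlD : ∀ t, (lD t).Nodup)
    (Ψ : (Z : TDom 4 N') → Finset (TDom 4 (L * N')) × Finset (TBond 4 M (L * N')) → W.Φ → ℂ →
      (TPt 4 N' → ℂ) → (TDom 4 (L * N') → ℂ) → ℂ)
    (hP : ∀ Z t φ, ∀ θ ∈ ball (0 : ℂ) ρ, P Z t φ θ = term214 r (lZ Z t) (lD t) (Ψ Z t φ θ) 0 0)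
    (hΨσ : ∀ Z t φ, φ ∈ W.sp2 Z → ∀ θ ∈ ball (0 : ℂ) ρ, ∀ τ : TDom 4 (L * N') → ℂ, (∀ j, τ j ∈ Uτ) →
      SepHolOn Uσ (fun σ => Ψ Z t φ θ σ τ))
    (hΨτ : ∀ Z t φ, φ ∈ W.sp2 Z → ∀ θ ∈ ball (0 : ℂ) ρ, ∀ σ : TPt 4 N' → ℂ, (∀ j, σ j ∈ Uσ) →
      SepHolOn Uτ (fun τ => Ψ Z t φ θ σ τ))
    (hpt : ∀ Z t φ, φ ∈ W.sp2 Z → ∀ (σ : TPt 4 N' → ℂ) (τ : TDom 4 (L * N') → ℂ), (∀ j, σ j ∈ Uσ) →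
      (∀ j, τ j ∈ Uτ) → DifferentiableOn ℂ (fun θ => Ψ Z t φ θ σ τ) (ball (0 : ℂ) ρ)) :
    ∀ (Z : TDom 4 N') (φ : W.Φ), φ ∈ W.sp2 Z → ∀ t ∈ terms L M Z,
      DifferentiableOn ℂ (P Z t φ) (ball (0 : ℂ) ρ) := by
  intro Z φ hφ t _
  have h0σ : (0 : ℂ) ∈ Uσ := by simpa using hsubσ 0 (by simp) (mem_closedBall_self hr.le)
  have h0τ : (0 : ℂ) ∈ Uτ := by simpa using hsubτ 0 (by simp) (mem_closedBall_self hr.le)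
  have h := differentiableOn_term214_param (B := ℂ) hUσ hUτ hr hsubσ hsubτ (V := ball (0 : ℂ) ρ)
    (Ψ := fun θ => Ψ Z t φ θ) (fun θ hθ => hΨσ Z t φ hφ θ hθ) (fun θ hθ => hΨτ Z t φ hφ θ hθ)
    (fun σ τ hσ hτ => hpt Z t φ hφ σ τ hσ hτ) (hlZ Z t) (hlD t) (σ₀ := 0) (fun _ => h0σ) (τ₀ := 0) (fun _ => h0τ)
  exact h.congr fun θ hθ => hP Z t φ θ hθ

open Classical in
/-- **THE UNIFORM (2.26) HYPOTHESIS `h226` FROM THE CAUCHY MECHANISM** (torus model): if the pencil members' terms are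
generic terms (2.14) whose underintegral expressions `Ψ Z t φ θ` satisfy, for each `‖θ‖ < ρ`, the hypotheses of
`B13Lemma3TorusCauchy.h226_torus_of_cauchy` — separate holomorphy in `σ` on `Uσ ⊇ {|σ| ≤ e^{κ₁}}` and in `τ` on
`Uτ ⊇ {|τ| ≤ |τ(Y)|}` (the (2.18) radii) and the Gaussian sup bound `e^{−½a|P|}e^{a₅|Z|}` of (2.15)–(2.25) on the closed
polydiscs, UNIFORM IN θ — then (2.26) holds for every pencil member in the spelling of `TwoRunTorusRate` §3 (apply
that theorem at each θ to the term family `P(·, θ)`). [cite: Balaban1988RG2Cluster, (2.14)–(2.15) p.15, (2.26) p.17] -/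
theorem pencil_h226_of_cauchy (c : B13.Consts) (hκ₁ : 1 ≤ c.κ₁) (hα₆ : c.α₆ ≠ 0) (W : TwoTorusStep 4 L N')
    (P : (Z : TDom 4 N') → Finset (TDom 4 (L * N')) × Finset (TBond 4 M (L * N')) → W.Φ → ℂ → ℂ) {ρ a a₅ : ℝ}
    {Uσ Uτ : Set ℂ} (hUσ : IsOpen Uσ) (hUτ : IsOpen Uτ) (hUexp : closedBall (0 : ℂ) (Real.exp c.κ₁) ⊆ Uσ)
    (hUtau : ∀ Y : TDom 4 (L * N'), closedBall (0 : ℂ) ((invTau c ((tsys 4 (L * N')).dj Y))⁻¹) ⊆ Uτ)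
    {r : ℝ} (hr : 0 < r) (hr' : r ≤ Real.exp c.κ₁ - 1)
    (hsubτ : ∀ s ∈ Set.uIcc (0 : ℝ) 1, closedBall (s : ℂ) r ⊆ Uτ)
    (hpos : ∀ Y : TDom 4 (L * N'), 0 < invTau c ((tsys 4 (L * N')).dj Y))
    (h2 : ∀ Y : TDom 4 (L * N'), invTau c ((tsys 4 (L * N')).dj Y) ≤ 1 / 2)
    (lZ : TDom 4 N' → Finset (TDom 4 (L * N')) × Finset (TBond 4 M (L * N')) → List (TPt 4 N'))
    (hlZ : ∀ Z t, (lZ Z t).Nodup ∧ (lZ Z t).toFinset = Z.1 \ tclosure L N' (Z0 M t))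
    (lD : Finset (TDom 4 (L * N')) × Finset (TBond 4 M (L * N')) → List (TDom 4 (L * N')))
    (hlD : ∀ t, (lD t).Nodup ∧ (lD t).toFinset = t.1)
    (Ψ : (Z : TDom 4 N') → Finset (TDom 4 (L * N')) × Finset (TBond 4 M (L * N')) → W.Φ → ℂ →
      (TPt 4 N' → ℂ) → (TDom 4 (L * N') → ℂ) → ℂ)
    (hP : ∀ Z t φ, ∀ θ ∈ ball (0 : ℂ) ρ, P Z t φ θ = term214 r (lZ Z t) (lD t) (Ψ Z t φ θ) 0 0)
    (hΨσ : ∀ Z t φ, φ ∈ W.sp2 Z → ∀ θ ∈ ball (0 : ℂ) ρ, ∀ τ : TDom 4 (L * N') → ℂ, (∀ j, τ j ∈ Uτ) →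
      SepHolOn Uσ (fun σ => Ψ Z t φ θ σ τ))
    (hΨτ : ∀ Z t φ, φ ∈ W.sp2 Z → ∀ θ ∈ ball (0 : ℂ) ρ, ∀ σ : TPt 4 N' → ℂ, (∀ j, σ j ∈ Uσ) →
      SepHolOn Uτ (fun τ => Ψ Z t φ θ σ τ))
    (hK : ∀ Z t φ, φ ∈ W.sp2 Z → ∀ θ ∈ ball (0 : ℂ) ρ, ∀ (σ : TPt 4 N' → ℂ) (τ : TDom 4 (L * N') → ℂ),
      (∀ j, ‖σ j‖ ≤ Real.exp c.κ₁) → (∀ Y, ‖τ Y‖ ≤ (invTau c ((tsys 4 (L * N')).dj Y))⁻¹) →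
      ‖Ψ Z t φ θ σ τ‖ ≤ Real.exp (-(a / 2 * (t.2.card : ℝ))) * Real.exp (a₅ * ((Z.1).card : ℝ))) :
    ∀ θ ∈ ball (0 : ℂ) ρ, ∀ (Z : TDom 4 N') (φ : W.Φ), φ ∈ W.sp2 Z → ∀ t ∈ terms L M Z,
      ‖P Z t φ θ‖ ≤ weight L M c Z a t * Real.exp (a₅ * ((Z.1).card : ℝ)) := by
  intro θ hθ Z φ hφ t ht
  -- `h226_torus_of_cauchy` wants the (2.14)-form for all `(Z, t, φ)`; feed it the θ-member with the junk-free reading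
  -- `T Z t φ := term214 r (lZ Z t) (lD t) (Ψ Z t φ θ) 0 0` and transport to `P` on the disc by `hP`.
  have h := h226_torus_of_cauchy c hκ₁ hα₆ W (fun Z t φ => term214 r (lZ Z t) (lD t) (Ψ Z t φ θ) 0 0) hUσ hUτ hUexp
    hUtau hr hr' hsubτ hpos h2 lZ hlZ lD hlD (fun Z t φ => Ψ Z t φ θ) (fun Z t φ => rfl)
    (fun Z t φ hφ => hΨσ Z t φ hφ θ hθ) (fun Z t φ hφ => hΨτ Z t φ hφ θ hθ) (fun Z t φ hφ => hK Z t φ hφ θ hθ)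
  rw [hP Z t φ θ hθ]
  exact h Z φ hφ t ht

end TorusCauchy

end Summit.QuantumFields.BalabanUV.T4Continuum.Spine.NE5.TwoRunTorusRateCauchy

end
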